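import Literature.AlgebraicGeometry.GroupSchemes.GroupSchemeActionFreeProperBaseChange
import Mathlib.AlgebraicGeometry.PullbackCarrier
import HarnessLib

/-!
# Separated actions under base change (MFK Def. 0.8 (ii)); the image of a base change is the preimage of the image

Mumford–Fogarty–Kirwan, *GIT*, Ch. 0 §3, Def. 0.8 (pp. 9–10): an action `σ` of `G/S` on `X/S` is
(ii) *separated* if the image of `Ψ = (σ, p₂) : G ×_S X → X ×_S X` is closed, (iii) proper if `Ψ` is
proper, (iv) free if `Ψ` is a closed immersion; Ch. 0 §4, proof of Prop. 0.9 (p. 16) moves an action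
along a base extension `S' → S`.  The tree (`GroupSchemeActionProperFree`,
`GroupSchemeActionFreeProperBaseChange`) has the three notions and proves that (iii) and (iv) are
stable under base change (`IsProperAction.baseChange`, `IsFreeAction.baseChange`) through
`ActionBaseChange.shear_left_baseChange (P) [P.IsStableUnderBaseChange]`; (ii) was left aside there.

This file proves that **(ii) is stable under base change as well**, with no definition, no instance,
no named fact:

* §1 (schemes) for a cartesian square `W —fst→ X, W —snd→ Y` over `f : X → Z ← Y : g`, the image of
  `fst` is the preimage under `f` of the image of `g` (`range_eq_preimage_range_of_isPullback`;
  Görtz–Wedhorn Lemma 4.28 (1): a pair of points `x ∈ X`, `y ∈ Y` with `f x = g y` lifts to a point of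
  `X ×_Z Y` — Mathlib `Scheme.Pullback.exists_preimage_pullback`), hence a base change of a morphism
  with closed image has closed image (`isClosed_range_of_isPullback`), i.e. the morphism property
  `topologically (IsClosed (Set.range ·))` respects isomorphisms and is stable under base change
  (`isClosedRange_respectsIso`, `isClosedRange_isStableUnderBaseChange`; Görtz–Wedhorn Prop. 4.32 (2)
  proves "surjective" is stable under base change by the same Lemma 4.28);
* §2 **`IsSeparatedAction.baseChange g`**: if the action of `G` on `X` is separated then so is the
  base-changed action of `G ×_S S'` on `X ×_S S'` (the transported action
  `ActionBaseChange.actionObj (Over.pullback g) G X`, named explicitly as in the sibling files), and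
  the functorial form `ActionBaseChange.isSeparatedAction_obj_iff` for any monoidal functor of slice
  categories (`Ψ_{F G, F X}` has closed image iff `F Ψ` has).

## References

* D. Mumford, J. Fogarty, F. Kirwan, *Geometric Invariant Theory*, 3rd ed., Springer (1994): Ch. 0
  §3, Def. 0.8 (ii) (pp. 9–10); Ch. 0 §4, Prop. 0.9, proof (p. 16). [MumfordFogartyKirwan1994]
* U. Görtz, T. Wedhorn, *Algebraic Geometry I: Schemes*, 2nd ed. (2020): Section (4.8) Lemma 4.28
  (points of fibre products), Prop. 4.32 (2) (permanence under base change). [GortzWedhorn2020]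

## Design notes

* Cell hodgecm-mathlib (D-0151), F-DAG capital in the (h3) group-scheme lineage; consumers: F-7
  (7b)/(7c) bookkeeping of the `GL`-action along `T → S`.  HC_CM is proved only modulo the 7 printed
  citations until rung 0 closes; this file asserts nothing about HC.
* Mathlib / Literature searches: Mathlib has `Scheme.Pullback.range_fst/range_snd`
  (`Set.range (pullback.fst f g) = f ⁻¹' Set.range g`), `Scheme.Pullback.exists_preimage_pullback`,
  `AlgebraicGeometry.topologically`, `IsStableUnderBaseChange.mk'`, and the analogous instance for
  `Surjective`; it has no morphism property "closed image".  Literature has `IsSeparatedAction`,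
  `isSeparatedAction_iff`, `ActionBaseChange.shear_obj_left_iff/shear_left_baseChange`.  Nothing is
  restated.
-/

universe u

open CategoryTheory Limits MonoidalCategory CartesianMonoidalCategory AlgebraicGeometry

namespace Literature.AlgebraicGeometry.GroupSchemes

open scoped MonObj Obj

/-! ### §1 The image of a base change is the preimage of the image -/

section Range

variable {W X Y Z : Scheme.{u}} {fst : W ⟶ X} {snd : W ⟶ Y} {f : X ⟶ Z} {g : Y ⟶ Z}

/-- **The image of a base change is the preimage of the image**: for a cartesian square
`fst : W → X`, `snd : W → Y` over `f : X → Z`, `g : Y → Z`, `fst(W) = f⁻¹(g(Y))` (a pair of points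
with the same image in `Z` lifts to the fibre product).
[cite: GortzWedhorn2020, Section (4.8) Lemma 4.28] -/
theorem range_eq_preimage_range_of_isPullback (H : IsPullback fst snd f g) :
    Set.range fst = f ⁻¹' Set.range g := by
  rw [← H.isoPullback_hom_fst, Scheme.Hom.comp_base, TopCat.coe_comp, Set.range_comp,
    Set.range_eq_univ.mpr H.isoPullback.hom.surjective, Set.image_univ, Scheme.Pullback.range_fst]

/-- **A base change of a morphism with closed image has closed image.**
[cite: GortzWedhorn2020, Prop. 4.32 (2)] -/
theorem isClosed_range_of_isPullback (H : IsPullback fst snd f g) (hg : IsClosed (Set.range g)) :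
    IsClosed (Set.range fst) := by
  rw [range_eq_preimage_range_of_isPullback H]
  exact hg.preimage f.continuous

/-- The morphism property "the image is closed" respects isomorphisms.
[cite: GortzWedhorn2020, Prop. 4.32 (2)] -/
theorem isClosedRange_respectsIso :
    (AlgebraicGeometry.topologically.{u} (fun f => IsClosed (Set.range f))).RespectsIso := by
  refine MorphismProperty.RespectsIso.mk _ (fun e f hf => ?_) (fun e f hf => ?_)
  · show IsClosed (Set.range (e.hom ≫ f))
    rw [Scheme.Hom.comp_base, TopCat.coe_comp, Set.range_comp,
      Set.range_eq_univ.mpr e.hom.surjective, Set.image_univ]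
    exact hf
  · show IsClosed (Set.range (f ≫ e.hom))
    rw [Scheme.Hom.comp_base, TopCat.coe_comp, Set.range_comp]
    exact e.hom.isClosedEmbedding.isClosedMap _ hf

/-- **The morphism property "the image is closed" is stable under base change.**
[cite: GortzWedhorn2020, Prop. 4.32 (2)] -/
theorem isClosedRange_isStableUnderBaseChange :
    (AlgebraicGeometry.topologically.{u} (fun f => IsClosed (Set.range f))).IsStableUnderBaseChange :=
  @MorphismProperty.IsStableUnderBaseChange.mk' _ _ _ isClosedRange_respectsIso.{u}
    fun _ _ _ f g _ hg => isClosed_range_of_isPullback (IsPullback.of_hasPullback f g) hg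

end Range

/-! ### §2 Separated actions under base change -/

namespace ActionBaseChange

section Functor

variable {S S' : Scheme.{u}} (F : Over S ⥤ Over S') [F.Monoidal] (G X : Over S) [GrpObj G]
  [σ : ModObj G X]

/-- **`Ψ_{F G, F X}` has closed image iff `F(Ψ)` has** (the two differ by isomorphisms).
[cite: MumfordFogartyKirwan1994, Ch. 0 §4, Prop. 0.9, proof (p. 16)] -/
theorem isSeparatedAction_obj_iff :
    IsSeparatedAction (F.obj G) (F.obj X) (σ := actionObj F G X) ↔
      IsClosed (Set.range (F.map (shear G X)).left) :=
  @shear_obj_left_iff S S' F _ G X _ σ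
    (AlgebraicGeometry.topologically.{u} (fun f => IsClosed (Set.range f))) isClosedRange_respectsIso.{u}

end Functor

end ActionBaseChange

section Schemes

variable {S S' : Scheme.{u}} (g : S' ⟶ S) {G X : Over S} [GrpObj G] [σ : ModObj G X]

/-- **A separated action stays separated after base change** (MFK Def. 0.8 (ii): the image of
`Ψ_{G ×_S S', X ×_S S'} ` is the preimage of the image of `Ψ_{G,X}` under `X' ×_{S'} X' → X ×_S X`).
[cite: MumfordFogartyKirwan1994, Ch. 0 §4, Prop. 0.9, proof (p. 16)] -/
theorem IsSeparatedAction.baseChange (h : IsSeparatedAction G X) :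
    IsSeparatedAction ((Over.pullback g).obj G) ((Over.pullback g).obj X)
      (σ := ActionBaseChange.actionObj (Over.pullback g) G X) :=
  @ActionBaseChange.shear_left_baseChange S S' g G X _ σ
    (AlgebraicGeometry.topologically.{u} (fun f => IsClosed (Set.range f)))
    isClosedRange_isStableUnderBaseChange.{u} h

/-- The image of the base-changed `Ψ` is the preimage of the image of `Ψ`:
`Ψ'(G' ×_{S'} X') = q⁻¹(Ψ(G ×_S X))` for `q : (X ×_S X) ×_S S' → X ×_S X`.
[cite: MumfordFogartyKirwan1994, Ch. 0 §4, Prop. 0.9, proof (p. 16)] -/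
theorem range_pullback_map_shear_left :
    Set.range ((Over.pullback g).map (shear G X)).left =
      pullback.fst (X ⊗ X).hom g ⁻¹' Set.range (shear G X).left :=
  range_eq_preimage_range_of_isPullback (Limits.isPullback_pullback_map_left g (shear G X))

end Schemes

end Literature.AlgebraicGeometry.GroupSchemes
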